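import Summits.BirchSwinnertonDyer.BirchSwinnertonDyer.Theorems.ThetaPartnerAtTwoSignedKatoUpToAtTwoPointsLocalCover
import Summits.BirchSwinnertonDyer.BirchSwinnertonDyer.Theorems.ThetaPartnerAtTwoSignedKatoUpToAtTwoLocalTwoPlusColemanKernelSigned
import Summits.BirchSwinnertonDyer.BirchSwinnertonDyer.Theorems.ThetaPartnerAtTwoSignedControlAtTwoPlusLocalInjOfHonda
import HarnessLib

/-!
# Route `ThetaPartnerAtTwo` (TP2), crux K3 `SignedKatoDivisibilityUpToAtTwo` (item stmt-BirchSwinnertonDyer-20308),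
# line `colemanrat` v4 — **`Ker Col♭ ⊆ ker j`**: the width seat's points-model map `j : Hom(E⁺(K_∞·K_v), ℤ_p) → X⁺`
# kills every functional whose ♭-Coleman value vanishes (plus Honda system with `a_p = 0`), so `j` DESCENDS to the
# quotient `P := Hom(E(K_∞·K_v), ℤ_p) ⧸ Ker Col♭` on which `ι := Col♭` is injective — the (Col) clause of K3's registered
# stub `stub_localRobustPackageTwo` for the points model holds with `m = 0` by construction.

Lead `bsd-wall-tp2-p2x` g4 (cell `bsd-wall`). HONEST FRAMING: THEOREMS ONLY — no definition, no named fact, no instance, no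
`sorry`; closes no item; CONVENTION-FREE (one side of Poitou–Tate only, cf. `Cruxes/…/G4-CONVENTION-AUDIT.md`); BSD is NOT
proved by any of this. Inputs: lead g3's `LocalTwo.colemanKer_flat_apply_eq_zero_of_mem_signedLocalPointsOfEmb_one_of_honda`
(`Ker Col♭ ⊆ ann(E⁺(K_n·K_v))`), K4's `SignedEC.signedSelmerInfty_le_localKummerOverOfEmb_iSup_signedLocalPoints` and
`SignedEC.index_subgroupOf_localLayerSubgroupOfEmb_succ_eq`, the `bsd-2adic` cell's `SSFlatEC.eq_zero_of_mem_localTowerPointsOfEmb_of_two_nsmul`.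

## What is proved

* `toDual_pointsModelJ_comp_eq_zero_of_mem_colemanKer_flat` — number field `K`, `v ∋ p`, (NT), layer indices `p`, a local lift `g`
  of the generator and a plus Honda system `c` ((L)(TR)(GEN)(GEN₀)) at the chosen place: for every pinned `D`, every additive `j` with
  the value formula of `KummerPoint.exists_pointsModelJ` (sign `+1`) and every functional `z ∈ Ker Col♭` on `E(K_∞·K_v)`:
  `D.toDual (j (z|_{A⁺})) = 0`, hence `j (z|_{A⁺}) = 0` (`pointsModelJ_comp_eq_zero_of_mem_colemanKer_flat`).
* `pointsModelJ_comp_eq_zero_of_mem_colemanKer_flat_two` — the `p = 2` spelling on K3's habitat (`W/ℚ` globally minimal,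
  `GoodSS W 2`, cyclotomic `κ`, the place above `2`): (NT) and the layer indices discharged; the Honda system `d` and the local lift
  `g` stay explicit (they are ∃-supplied by `Cruxes.SignedControlAtTwo.EulerChar.stub_plusHondaSystemTwo` = HONDA⁺@2 and
  `ZpExtension.IsCyclotomic.exists_apply_resGalOfEmb_adicCompletion_eq`).

References: [Kobayashi2003] Thm. 6.2 (p. 11), Prop. 8.12 i), Prop. 8.18–8.23, (7.17) (p. 12); [Sprung2012] Def. 7.9, p. 1485.
-/

set_option autoImplicit false
-- the Theorems namespace of this sub repeats the summit name by design (D-0017 nested layout)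
set_option linter.dupNamespace false

noncomputable section

open scoped Classical

namespace Summit.BirchSwinnertonDyer.BirchSwinnertonDyer.Theorems

namespace SignedKatoOffTwo.KummerPoint

open NumberField IsDedekindDomain Field WeierstrassCurve
  Literature.NumberTheory.EllipticCurves Literature.NumberTheory.EllipticCurves.Kobayashi2003
  Literature.NumberTheory.EllipticCurves.Sprung2012 Literature.NumberTheory.GaloisRepresentations ZpExtension
  Literature.NumberTheory.EllipticCurves.Sprung2017

universe u

/-! ## §1 `Ker Col♭ ⊆ ker j` (number field `K`, place `v ∋ p`, plus Honda system) -/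

section General

variable {K : Type u} [Field K] [NumberField K] (W : WeierstrassCurve K) (p : ℕ) [Fact p.Prime]
  (κ : ZpExtension K p) {γ : absoluteGaloisGroup K}

/-- **`Ker Col♭ ⊆ ker j`, value form.** For a plus Honda system `c` with `a_p = 0` at the chosen place above `v ∋ p` ((NT), layer indices
`p`, local lift `g` of the generator), every `z ∈ Ker Col♭` and every additive `j` with the value formula of `exists_pointsModelJ`
(sign `+1`): `D.toDual (j (z|_{A⁺})) s = 0` for all `s ∈ Sel⁺(E/K_∞)` — the Kummer witness `(Q, k)` of `s` has `p^k Q ∈ A⁺ = ⨆ₙ E⁺_n`,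
where `z` vanishes (`LocalTwo.colemanKer_flat_apply_eq_zero_of_mem_signedLocalPointsOfEmb_one_of_honda`).
[cite: Kobayashi2003, Thm. 6.2 (p. 11), (7.17) (p. 12)] [cite: Sprung2012, Def. 7.9 (p. 1503)] -/
theorem toDual_pointsModelJ_comp_eq_zero_of_mem_colemanKer_flat (v : HeightOneSpectrum (𝓞 K)) (hv : (p : 𝓞 K) ∈ v.asIdeal)
    (hnt : ∀ P ∈ localTowerPointsOfEmb κ (closureEmb (K := K) (v.adicCompletion K)) W, p • P = 0 → P = 0)
    (hidx : ∀ m : ℕ, ((localLayerSubgroupOfEmb κ (closureEmb (K := K) (v.adicCompletion K)) (m + 1)).subgroupOf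
      (localLayerSubgroupOfEmb κ (closureEmb (K := K) (v.adicCompletion K)) m)).index = p)
    {g : absoluteGaloisGroup (v.adicCompletion K)} (hg : κ.IsTopGenerator (resGalOfEmb (closureEmb (K := K) (v.adicCompletion K)) g))
    {c : ℕ → localPoints W (v.adicCompletion K)} (hc : ∀ m, c m ∈ localLayerPoints κ (v.adicCompletion K) W m)
    (htr : ∀ m, localTrace κ (v.adicCompletion K) W (m + 1) (m + 2) (c (m + 2)) = -c m)
    (hgen : ∀ m : ℕ, 1 ≤ m → ∀ P ∈ localLayerPoints κ (v.adicCompletion K) W m,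
      ∃ B ∈ AddSubgroup.closure (Set.range fun σ : absoluteGaloisGroup (v.adicCompletion K) ↦ σ • c m),
        ∃ P' ∈ localLayerPoints κ (v.adicCompletion K) W (m - 1), ∃ R ∈ localLayerPoints κ (v.adicCompletion K) W m,
          P = B + P' + p • R)
    (hgen0 : ∀ P ∈ localLayerPoints κ (v.adicCompletion K) W 0, ∃ a : ℤ, ∃ R ∈ localLayerPoints κ (v.adicCompletion K) W 0,
      P = a • c 0 + p • R)
    (D : SignedSelmerDualData W κ γ 1)
    (j : (↥(⨆ n, signedLocalPoints κ (v.adicCompletion K) W 1 n) →+ ℤ_[p]) →+ D.X)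
    (hj : ∀ (φA : ↥(⨆ n, signedLocalPoints κ (v.adicCompletion K) W 1 n) →+ ℤ_[p])
        (s : W.subgroupH1 p κ.kerSubgroup) (hs : s ∈ signedSelmerInfty W κ 1)
        (φ : contOneCocycles (discreteTopRep κ.kerSubgroup (W.geomPrimaryTorsion p)))
        (Q : localPoints W (v.adicCompletion K)) (k : ℕ)
        (_ : oneCocycleClass _ φ = s) (hQ : p ^ k • Q ∈ (⨆ n, signedLocalPoints κ (v.adicCompletion K) W 1 n))
        (_ : ∀ τ : localSubgroupOfEmb κ.kerSubgroup (closureEmb (K := K) (v.adicCompletion K)),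
          pointsMapOfEmb W (closureEmb (K := K) (v.adicCompletion K))
              ((φ.1 (resGalSubgroupOfEmb κ.kerSubgroup _ τ) : W.geomPrimaryTorsion p) : W.geomPoints) =
            (τ : absoluteGaloisGroup (v.adicCompletion K)) • Q - Q),
        D.toDual (j φA) ⟨s, hs⟩ =
          (PadicInt.toZModPow k (φA ⟨p ^ k • Q, hQ⟩)).val • ((((p : ℚ) ^ k)⁻¹ : ℚ) : AddCircle (1 : ℚ)))
    {z : localTowerPointsOfEmb κ (closureEmb (K := K) (v.adicCompletion K)) W →+ ℤ_[p]}
    (hz : z ∈ colemanKer κ (closureEmb (K := K) (v.adicCompletion K)) W 0 g c .flat)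
    (s : W.subgroupH1 p κ.kerSubgroup) (hs : s ∈ signedSelmerInfty W κ 1) :
    D.toDual (j (z.comp (AddSubgroup.inclusion (iSup_signedLocalPoints_le_localTowerPointsOfEmb W p κ 1 v)))) ⟨s, hs⟩ = 0 := by
  have hs' := SignedEC.signedSelmerInfty_le_localKummerOverOfEmb_iSup_signedLocalPoints W κ 1 v hv hs
  obtain ⟨φ, Q, k, hφ, hQ, hτ⟩ := (mem_localKummerOverOfEmb_iff _ s).1 hs'
  rw [hj _ s hs φ Q k hφ hQ hτ]
  -- `p^k Q` lies in some `E⁺_n`, where `z` vanishes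
  obtain ⟨n, hn⟩ := (mem_iSup_signedLocalPointsOfEmb_iff W κ (closureEmb (K := K) (v.adicCompletion K)) 1 (p ^ k • Q)).1 hQ
  have hz0 := LocalTwo.colemanKer_flat_apply_eq_zero_of_mem_signedLocalPointsOfEmb_one_of_honda hnt hidx hg hc htr hgen hgen0 hz n
    (p ^ k • Q) hn
  have e : (z.comp (AddSubgroup.inclusion (iSup_signedLocalPoints_le_localTowerPointsOfEmb W p κ 1 v))) ⟨p ^ k • Q, hQ⟩ = 0 := by
    rw [AddMonoidHom.comp_apply, ← hz0]
    rfl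
  rw [e, map_zero, ZMod.val_zero, zero_smul]

/-- **`Ker Col♭ ⊆ ker j`.** Same hypotheses: `j (z|_{A⁺}) = 0` for every `z ∈ Ker Col♭` (`D.toDual` is injective). So `j` descends to
`Hom(E(K_∞·K_v), ℤ_p) ⧸ Ker Col♭`, on which `Col♭` is injective: the (Col) clause of the points-model package, exponent `m = 0`.
[cite: Kobayashi2003, Thm. 6.2 (p. 11), (7.17) (p. 12)] [cite: Sprung2012, Def. 7.9 (p. 1503)] -/
theorem pointsModelJ_comp_eq_zero_of_mem_colemanKer_flat (v : HeightOneSpectrum (𝓞 K)) (hv : (p : 𝓞 K) ∈ v.asIdeal)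
    (hnt : ∀ P ∈ localTowerPointsOfEmb κ (closureEmb (K := K) (v.adicCompletion K)) W, p • P = 0 → P = 0)
    (hidx : ∀ m : ℕ, ((localLayerSubgroupOfEmb κ (closureEmb (K := K) (v.adicCompletion K)) (m + 1)).subgroupOf
      (localLayerSubgroupOfEmb κ (closureEmb (K := K) (v.adicCompletion K)) m)).index = p)
    {g : absoluteGaloisGroup (v.adicCompletion K)} (hg : κ.IsTopGenerator (resGalOfEmb (closureEmb (K := K) (v.adicCompletion K)) g))
    {c : ℕ → localPoints W (v.adicCompletion K)} (hc : ∀ m, c m ∈ localLayerPoints κ (v.adicCompletion K) W m)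
    (htr : ∀ m, localTrace κ (v.adicCompletion K) W (m + 1) (m + 2) (c (m + 2)) = -c m)
    (hgen : ∀ m : ℕ, 1 ≤ m → ∀ P ∈ localLayerPoints κ (v.adicCompletion K) W m,
      ∃ B ∈ AddSubgroup.closure (Set.range fun σ : absoluteGaloisGroup (v.adicCompletion K) ↦ σ • c m),
        ∃ P' ∈ localLayerPoints κ (v.adicCompletion K) W (m - 1), ∃ R ∈ localLayerPoints κ (v.adicCompletion K) W m,
          P = B + P' + p • R)
    (hgen0 : ∀ P ∈ localLayerPoints κ (v.adicCompletion K) W 0, ∃ a : ℤ, ∃ R ∈ localLayerPoints κ (v.adicCompletion K) W 0,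
      P = a • c 0 + p • R)
    (D : SignedSelmerDualData W κ γ 1)
    (j : (↥(⨆ n, signedLocalPoints κ (v.adicCompletion K) W 1 n) →+ ℤ_[p]) →+ D.X)
    (hj : ∀ (φA : ↥(⨆ n, signedLocalPoints κ (v.adicCompletion K) W 1 n) →+ ℤ_[p])
        (s : W.subgroupH1 p κ.kerSubgroup) (hs : s ∈ signedSelmerInfty W κ 1)
        (φ : contOneCocycles (discreteTopRep κ.kerSubgroup (W.geomPrimaryTorsion p)))
        (Q : localPoints W (v.adicCompletion K)) (k : ℕ)
        (_ : oneCocycleClass _ φ = s) (hQ : p ^ k • Q ∈ (⨆ n, signedLocalPoints κ (v.adicCompletion K) W 1 n))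
        (_ : ∀ τ : localSubgroupOfEmb κ.kerSubgroup (closureEmb (K := K) (v.adicCompletion K)),
          pointsMapOfEmb W (closureEmb (K := K) (v.adicCompletion K))
              ((φ.1 (resGalSubgroupOfEmb κ.kerSubgroup _ τ) : W.geomPrimaryTorsion p) : W.geomPoints) =
            (τ : absoluteGaloisGroup (v.adicCompletion K)) • Q - Q),
        D.toDual (j φA) ⟨s, hs⟩ =
          (PadicInt.toZModPow k (φA ⟨p ^ k • Q, hQ⟩)).val • ((((p : ℚ) ^ k)⁻¹ : ℚ) : AddCircle (1 : ℚ)))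
    {z : localTowerPointsOfEmb κ (closureEmb (K := K) (v.adicCompletion K)) W →+ ℤ_[p]}
    (hz : z ∈ colemanKer κ (closureEmb (K := K) (v.adicCompletion K)) W 0 g c .flat) :
    j (z.comp (AddSubgroup.inclusion (iSup_signedLocalPoints_le_localTowerPointsOfEmb W p κ 1 v))) = 0 := by
  apply D.bijective.1
  rw [map_zero]
  ext ⟨s, hs⟩
  rw [AddMonoidHom.zero_apply]
  exact toDual_pointsModelJ_comp_eq_zero_of_mem_colemanKer_flat W p κ v hv hnt hidx hg hc htr hgen hgen0 D j hj hz s hs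

end General

/-! ## §2 `p = 2` on K3's habitat: (NT) and the layer indices discharged -/

section Two

variable (W : WeierstrassCurve ℚ) [W.IsElliptic] [W.IsGloballyMinimal] {κ : ZpExtension ℚ 2} {γ : absoluteGaloisGroup ℚ}

/-- **`Ker Col♭ ⊆ ker j` at `p = 2`** for `W/ℚ` globally minimal with `GoodSS W 2`, the cyclotomic `κ`, the place `v ∋ 2`, any local lift `g`
of the generator and any plus Honda system `d` at `v` with (L)(TR)(GEN)(GEN₀) (∃-supplied by HONDA⁺@2 =
`Cruxes.SignedControlAtTwo.EulerChar.stub_plusHondaSystemTwo`): `j (z|_{A⁺}) = 0` for every `z ∈ Ker Col♭` and every `j` with the value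
formula of `KummerPoint.exists_pointsModelJ_two`. [cite: Kobayashi2003, Thm. 6.2 (p. 11), (7.17) (p. 12)] [cite: Sprung2012, Thm. 2.2 (2′), Def. 7.9] -/
theorem pointsModelJ_comp_eq_zero_of_mem_colemanKer_flat_two (hss : Rank1Residual.GoodSS W 2) (hκ : κ.IsCyclotomic)
    (v : HeightOneSpectrum (𝓞 ℚ)) (hv : (2 : 𝓞 ℚ) ∈ v.asIdeal)
    {g : absoluteGaloisGroup (v.adicCompletion ℚ)} (hg : κ.IsTopGenerator (resGalOfEmb (closureEmb (K := ℚ) (v.adicCompletion ℚ)) g))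
    {d : ℕ → localPoints W (v.adicCompletion ℚ)} (hd : ∀ m, d m ∈ localLayerPoints κ (v.adicCompletion ℚ) W m)
    (htr : ∀ m, localTrace κ (v.adicCompletion ℚ) W (m + 1) (m + 2) (d (m + 2)) = -d m)
    (hgen : ∀ m : ℕ, 1 ≤ m → ∀ P ∈ localLayerPoints κ (v.adicCompletion ℚ) W m,
      ∃ B ∈ AddSubgroup.closure (Set.range fun σ : absoluteGaloisGroup (v.adicCompletion ℚ) ↦ σ • d m),
        ∃ P' ∈ localLayerPoints κ (v.adicCompletion ℚ) W (m - 1), ∃ R ∈ localLayerPoints κ (v.adicCompletion ℚ) W m,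
          P = B + P' + 2 • R)
    (hgen0 : ∀ P ∈ localLayerPoints κ (v.adicCompletion ℚ) W 0, ∃ a : ℤ, ∃ R ∈ localLayerPoints κ (v.adicCompletion ℚ) W 0,
      P = a • d 0 + 2 • R)
    (D : SignedSelmerDualData W κ γ 1)
    (j : (↥(⨆ n, signedLocalPoints κ (v.adicCompletion ℚ) W 1 n) →+ ℤ_[2]) →+ D.X)
    (hj : ∀ (φA : ↥(⨆ n, signedLocalPoints κ (v.adicCompletion ℚ) W 1 n) →+ ℤ_[2])
        (s : W.subgroupH1 2 κ.kerSubgroup) (hs : s ∈ signedSelmerInfty W κ 1)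
        (φ : contOneCocycles (discreteTopRep κ.kerSubgroup (W.geomPrimaryTorsion 2)))
        (Q : localPoints W (v.adicCompletion ℚ)) (k : ℕ)
        (_ : oneCocycleClass _ φ = s) (hQ : 2 ^ k • Q ∈ (⨆ n, signedLocalPoints κ (v.adicCompletion ℚ) W 1 n))
        (_ : ∀ τ : localSubgroupOfEmb κ.kerSubgroup (closureEmb (K := ℚ) (v.adicCompletion ℚ)),
          pointsMapOfEmb W (closureEmb (K := ℚ) (v.adicCompletion ℚ))
              ((φ.1 (resGalSubgroupOfEmb κ.kerSubgroup _ τ) : W.geomPrimaryTorsion 2) : W.geomPoints) =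
            (τ : absoluteGaloisGroup (v.adicCompletion ℚ)) • Q - Q),
        D.toDual (j φA) ⟨s, hs⟩ =
          (PadicInt.toZModPow k (φA ⟨2 ^ k • Q, hQ⟩)).val • ((((2 : ℚ) ^ k)⁻¹ : ℚ) : AddCircle (1 : ℚ)))
    {z : localTowerPointsOfEmb κ (closureEmb (K := ℚ) (v.adicCompletion ℚ)) W →+ ℤ_[2]}
    (hz : z ∈ colemanKer κ (closureEmb (K := ℚ) (v.adicCompletion ℚ)) W 0 g d .flat) :
    j (z.comp (AddSubgroup.inclusion (iSup_signedLocalPoints_le_localTowerPointsOfEmb W 2 κ 1 v))) = 0 := by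
  have hv' : ((2 : ℕ) : 𝓞 ℚ) ∈ v.asIdeal := by exact_mod_cast hv
  have hnt : ∀ P ∈ localTowerPointsOfEmb κ (closureEmb (K := ℚ) (v.adicCompletion ℚ)) W, (2 : ℕ) • P = 0 → P = 0 :=
    fun P hP h2 ↦ SSFlatEC.eq_zero_of_mem_localTowerPointsOfEmb_of_two_nsmul W hss κ hv _ hP (by exact_mod_cast h2)
  have hidx := SignedEC.index_subgroupOf_localLayerSubgroupOfEmb_succ_eq (p := 2) hκ v hv'
  exact pointsModelJ_comp_eq_zero_of_mem_colemanKer_flat W 2 κ v hv' hnt hidx hg hd htr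
    (fun m hm P hP ↦ by simpa using hgen m hm P hP) (fun P hP ↦ by simpa using hgen0 P hP) D j
    (fun φA s hs φ Q k hφ hQ hτ ↦ by simpa using hj φA s hs φ Q k hφ (by simpa using hQ) hτ) hz

end Two

end SignedKatoOffTwo.KummerPoint

end Summit.BirchSwinnertonDyer.BirchSwinnertonDyer.Theorems

end
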